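import Mathlib
import Summits.NavierStokesRegularity.NavierStokesRegularity.Theses.FrozenSignCascade
import Summits.NavierStokesRegularity.NavierStokesRegularity.Theorems.FrozenSignCascadeEnvelopeBoundStubMildUnique
import Literature.Analysis.FluidPDE.NSFourierAPriori
import HarnessLib

/-!
# Route FrozenSignCascade · crux `EnvelopeBound` (stmt-NavierStokesRegularity-1549): the crux at
  short horizons

Support file for the crux item stmt-NavierStokesRegularity-1549 (`EnvelopeBound`); lands
`--supports` that item (line `registered`, open stub `stub_highFrequencyBranch`).

**Theorem (`envelopeBound_shortHorizon`).** For every `ν > 0` and every Clay datum `u₀` there is a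
time `T⋆ = T⋆(ν, u₀) > 0` — Picard's time `picardTime (4π²ν) 4 (2A)` of the Fourier-side
construction, `A` an order-`4` weight of the Fourier datum `a = 𝓕⁻¹u₀` — and a constant `C = 2A`
such that EVERY Fourier-side mild solution `V` on `[0,T]`, `T ≤ T⋆`, from `a` obeys
`‖ξ‖² ‖V t ξ‖ ≤ C` on `[0,T] × ℝ³`. That is, the conclusion of the crux `EnvelopeBound` holds at
every horizon `T₀ ≤ T⋆(ν,u₀)` (`envelopeBound_of_le_picardTime`), with a constant independent of the
horizon: by uniqueness in the Fourier-mild class (`Registered.stub_mildUnique`) `V` is the Picard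
limit, which stays in the order-`4` ball of radius `2A` (`PicardHyp.decay_limit`). The content of
the crux is therefore entirely in LONG horizons `T₀ > T⋆(ν,u₀)` for LARGE data (for which `T⋆` is
small), as for the Clay problem itself.
-/

noncomputable section

set_option linter.dupNamespace false -- nested layout Summit.<S>.<Sub>, Sub = S (D-0017)

open Set MeasureTheory Filter Topology
open Literature.Analysis.FluidPDE Literature.Analysis.FluidPDE.FourierNS

namespace Summit.NavierStokesRegularity.NavierStokesRegularity.Theorems.EnvelopeBound.Registered

/-- `‖ξ‖² ≤ (1 + ‖ξ‖)⁴`: the critical envelope is dominated by the order-`4` weight. -/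
theorem norm_sq_le_weight_four {E : Type*} [NormedAddCommGroup E] (ξ : E) :
    ‖ξ‖ ^ 2 ≤ (1 + ‖ξ‖) ^ 4 := by
  have h0 : 0 ≤ ‖ξ‖ := norm_nonneg ξ
  have h1 : ‖ξ‖ ^ 2 ≤ (1 + ‖ξ‖) ^ 2 := pow_le_pow_left₀ h0 (by linarith) 2
  have h2 : (1 + ‖ξ‖) ^ 2 ≤ (1 + ‖ξ‖) ^ 4 :=
    pow_le_pow_right₀ (by linarith) (by norm_num)
  exact h1.trans h2

/-- **The crux at short horizons (uniform form).** For `ν > 0` and a Clay datum `u₀` with Fourier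
datum `a = fourierData hu hd`, let `A` be any order-`4` weight of `a` (`HasDecay 4 A a`). Then
along EVERY Fourier-mild solution `V` on `[0,T]` from `a` with
`T ≤ picardTime (Fin 3) (4π²ν) 4 (2A)`, the order-`4` weights stay below `2A`, hence
`‖ξ‖² ‖V t ξ‖ ≤ 2A` on `[0,T] × ℝ³`: `V` coincides with the Picard limit by uniqueness in the
Fourier-mild class, and the Picard limit stays in the ball (`PicardHyp.decay_limit`). -/
theorem sq_norm_mul_norm_le_of_le_picardTime {ν : ℝ} (hν : 0 < ν)
    {u₀ : EuclideanSpace ℝ (Fin 3) → EuclideanSpace ℝ (Fin 3)} (hu : ContDiff ℝ (⊤ : ℕ∞) u₀)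
    (hd : Literature.Analysis.FluidPDE.HasRapidSpatialDecay u₀)
    (hdiv : Literature.Analysis.FluidPDE.NSWave0.IsDivFree u₀) {A : ℝ}
    (hA : HasDecay 4 A (fourierData hu hd)) {T : ℝ}
    (hT : T ≤ picardTime (Fin 3) (4 * Real.pi ^ 2 * ν) 4 (2 * A))
    {V : ℝ → EuclideanSpace ℝ (Fin 3) → Fin 3 → ℂ}
    (hV : IsFourierMild (4 * Real.pi ^ 2 * ν) 4 0 T V) (hV0 : V 0 = fourierData hu hd) :
    ∀ t ∈ Icc 0 T, ∀ ξ : EuclideanSpace ℝ (Fin 3), ‖ξ‖ ^ 2 * ‖V t ξ‖ ≤ 2 * A := by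
  set c : ℝ := 4 * Real.pi ^ 2 * ν with hc
  have hc0 : 0 < c := by positivity
  set a := fourierData hu hd with ha
  -- the Picard hypotheses for the datum in the order-`4` ball of radius `A = (2A)/2`
  have hyp : PicardHyp c 4 (2 * A) a :=
    { hc := hc0
      hK₀ := by simp
      cont := continuous_fourierData hu hd
      decay := by
        have e : 2 * A / 2 = A := by ring
        rw [e]; exact hA }
  set TP : ℝ := picardTime (Fin 3) c 4 (2 * A) with hTP
  -- the Picard limit: mild on `[0, T_P]`, from `a`, in the ball of radius `2A`
  have hmild : IsFourierMild c 4 0 TP (picardLimit c TP a) :=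
    hyp.isFourierMild_limit rfl (hasDecay_fourierData hu hd) (sum_mul_fourierData hu hd hdiv)
      (fourierData_conj_symm hu hd)
  have hlim0 : picardLimit c TP a 0 = a := funext fun ξ => hyp.limit_zero rfl ξ
  have hball : ∀ t, HasDecay 4 (2 * A) (picardLimit c TP a t) := fun t => hyp.decay_limit rfl t
  intro t ht ξ
  -- uniqueness identifies `V` with the Picard limit on `[0, T]`
  have hVW : V t = picardLimit c TP a t :=
    stub_mildUnique c 4 0 T TP V (picardLimit c TP a) hV hmild (hV0.trans hlim0.symm) t ht.1 ht.2
      (ht.2.trans hT)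
  rw [congrFun hVW ξ]
  calc ‖ξ‖ ^ 2 * ‖picardLimit c TP a t ξ‖ ≤ (1 + ‖ξ‖) ^ 4 * ‖picardLimit c TP a t ξ‖ :=
        mul_le_mul_of_nonneg_right (norm_sq_le_weight_four ξ) (norm_nonneg _)
    _ ≤ 2 * A := weight_mul_norm_le (hball t) ξ

/-- **The crux at short horizons.** For every `ν > 0` and every Clay datum `u₀` there are a time
`T⋆ = T⋆(ν,u₀) > 0` and a constant `C = C(ν,u₀)` such that every Fourier-side mild solution `V` on
`[0,T]`, `T ≤ T⋆`, from the Fourier datum obeys `‖ξ‖² ‖V t ξ‖ ≤ C` on `[0,T] × ℝ³`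
(`T⋆` = Picard's time of the datum, `C = 2A`; uniqueness in the Fourier-mild class). -/
theorem envelopeBound_shortHorizon :
    ∀ ν : ℝ, 0 < ν →
      ∀ (u₀ : EuclideanSpace ℝ (Fin 3) → EuclideanSpace ℝ (Fin 3)) (hu : ContDiff ℝ (⊤ : ℕ∞) u₀)
        (hd : Literature.Analysis.FluidPDE.HasRapidSpatialDecay u₀),
        Literature.Analysis.FluidPDE.NSWave0.IsDivFree u₀ →
      ∃ Tstar : ℝ, 0 < Tstar ∧ ∃ C : ℝ, ∀ T : ℝ, T ≤ Tstar →
        ∀ V : ℝ → EuclideanSpace ℝ (Fin 3) → Fin 3 → ℂ,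
          Literature.Analysis.FluidPDE.FourierNS.IsFourierMild (4 * Real.pi ^ 2 * ν) 4 0 T V →
          V 0 = Literature.Analysis.FluidPDE.FourierNS.fourierData hu hd →
          ∀ t ∈ Set.Icc 0 T, ∀ ξ : EuclideanSpace ℝ (Fin 3), ‖ξ‖ ^ 2 * ‖V t ξ‖ ≤ C := by
  intro ν hν u₀ hu hd hdiv
  obtain ⟨A, hA⟩ := hasDecay_fourierData hu hd 4
  have hA0 : 0 ≤ A := hA.nonneg
  refine ⟨picardTime (Fin 3) (4 * Real.pi ^ 2 * ν) 4 (2 * A),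
    picardTime_pos (by positivity) 4 (2 * A) (by positivity), 2 * A, ?_⟩
  intro T hT V hV hV0
  exact sq_norm_mul_norm_le_of_le_picardTime hν hu hd hdiv hA hT hV hV0

/-- **`EnvelopeBound` at every horizon below Picard's time of the datum.** For every `ν > 0` and
Clay datum `u₀` there is `T⋆(ν,u₀) > 0` such that for every horizon `0 < T₀ ≤ T⋆` the conclusion
of the crux holds: there is `C` bounding `‖ξ‖² ‖V t ξ‖` along all Fourier-mild solutions on
`[0,T]`, `T ≤ T₀`, from the Fourier datum. The crux proper is the statement for ALL `T₀`. -/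
theorem envelopeBound_of_le_picardTime :
    ∀ ν : ℝ, 0 < ν →
      ∀ (u₀ : EuclideanSpace ℝ (Fin 3) → EuclideanSpace ℝ (Fin 3)) (hu : ContDiff ℝ (⊤ : ℕ∞) u₀)
        (hd : Literature.Analysis.FluidPDE.HasRapidSpatialDecay u₀),
        Literature.Analysis.FluidPDE.NSWave0.IsDivFree u₀ →
      ∃ Tstar : ℝ, 0 < Tstar ∧ ∀ T₀ : ℝ, 0 < T₀ → T₀ ≤ Tstar → ∃ C : ℝ, ∀ T : ℝ, T ≤ T₀ →
        ∀ V : ℝ → EuclideanSpace ℝ (Fin 3) → Fin 3 → ℂ,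
          Literature.Analysis.FluidPDE.FourierNS.IsFourierMild (4 * Real.pi ^ 2 * ν) 4 0 T V →
          V 0 = Literature.Analysis.FluidPDE.FourierNS.fourierData hu hd →
          ∀ t ∈ Set.Icc 0 T, ∀ ξ : EuclideanSpace ℝ (Fin 3), ‖ξ‖ ^ 2 * ‖V t ξ‖ ≤ C := by
  intro ν hν u₀ hu hd hdiv
  obtain ⟨Tstar, hTstar, C, hC⟩ := envelopeBound_shortHorizon ν hν u₀ hu hd hdiv
  exact ⟨Tstar, hTstar, fun T₀ _ hT₀ => ⟨C, fun T hT V hV hV0 => hC T (hT.trans hT₀) V hV hV0⟩⟩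

end Summit.NavierStokesRegularity.NavierStokesRegularity.Theorems.EnvelopeBound.Registered

end
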